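import Literature.NumberTheory.Automorphic.AutomorphicInductionCharacterDescent
import Literature.NumberTheory.Automorphic.ExistsClassFieldCharacterHolds
import Literature.NumberTheory.Automorphic.ClassFieldCharacterFrobenius
import HarnessLib

/-!
# Automorphic induction of a Hecke character (Arthur–Clozel, Ch. 3, Thm. 6.2 for `n = 1`):
# the class-field input discharged (proofs)

Topic `NumberTheory/Automorphic`; namespace `Literature.NumberTheory.Automorphic`. A proof file
(theorems only: no definition, no named fact, no instance) continuing
`AutomorphicInductionCharacterDescent`, whose theorem `automorphicInduction_character_of_leaves`
derives the named fact `automorphicInduction_character` (Arthur–Clozel 1989, Ch. 3, Thm. 6.2 with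
(6.1)–(6.2) for `π_E = ω`; Gelbart 1997, Thm. 5.3.1) from four inputs: `h42e` (Arthur–Clozel
Thm. 4.2 (e), the named fact `ArthurClozel1989_descent_of_galOrbit F E 1`), `hCFT` (the class-field
character of a Galois extension of prime degree *with its Frobenius values*), and `hB`, `hL2`
(Borel–Jacquet 1979, 4.6: the named facts `AutomorphicRepsGL.exists_cuspidalRepData_of_L2`,
`hasSatakeParamAt_iff_L2`).

The input `hCFT` is now a theorem of the tree, assembled here:

* `exists_isClassFieldCharacter_valueAtUniformizer_ne_one` (**proved**): for `E/F` Galois of prime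
  degree `l` there is a Hecke character `η` of `F` vanishing exactly on `F^× N(𝔸_E^×)`
  (`IsClassFieldCharacter`) with `η(ϖ_v) ≠ 1` at every finite place `v` with `e_v = 1`, `f_v = l`
  — existence by `exists_isClassFieldCharacter_holds` (`ExistsClassFieldCharacterHolds`: Tate's
  Main Theorem (B), Cassels–Fröhlich Ch. VII §5.1, for cyclic `E/F`), the Frobenius clause by
  `IsClassFieldCharacter.valueAtUniformizer_ne_one_of_inert` (`ClassFieldCharacterFrobenius`:
  `η(ϖ_v)` is a primitive `f_v`-th root of unity at unramified `v`, from
  `artinReciprocity_character_holds`; Arthur–Clozel, Ch. 3, p. 201, "`ζ_v` is a root of unity of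
  order `f_v`").
* `automorphicInduction_character_of_descent_and_BJ` (**proved**): the named fact
  `automorphicInduction_character` follows from the three named facts
  `ArthurClozel1989_descent_of_galOrbit F E 1` (all `F ⊆ E`),
  `AutomorphicRepsGL.exists_cuspidalRepData_of_L2` and `hasSatakeParamAt_iff_L2` (all `GL_n` over
  all number fields) alone. When these are discharged, `automorphicInduction_character_holds` is
  this theorem applied to their `_holds`.

## References

* J. Arthur, L. Clozel, *Simple algebras, base change, and the advanced theory of the trace
  formula*, Ann. of Math. Stud. 120 (1989), Ch. 3: Thm. 4.2 (e), Thm. 6.2, (6.1)–(6.2), and the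
  proof of Thm. 3.1 (p. 201). [ArthurClozelAMS120]
* S. Gelbart, *Three lectures on the modularity of `ρ̄_{E,3}` and the Langlands reciprocity
  conjecture* (1997), Thm. 5.3.1. [Gelbart1997]
* J. W. S. Cassels, A. Fröhlich (eds.), *Algebraic Number Theory* (1967), Ch. VII (Tate), §4.2
  Corollary, §5.1 Main Theorem (A), (B). [CasselsFrohlichANT1967]
* A. Borel, H. Jacquet, *Automorphic forms and automorphic representations*, Proc. Sympos. Pure
  Math. 33 (1979), Part 1, §4.6. [BorelJacquet1979]
-/

noncomputable section

open scoped MatrixGroups NumberField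
open NumberField IsDedekindDomain MeasureTheory Filter

namespace Literature.NumberTheory.Automorphic

open AdelicGroupData

/-- **The class-field character of a Galois extension of prime degree, with its Frobenius values
(Cassels–Fröhlich, Ch. VII §5.1 Main Theorem (A), (B) with §4.2 Corollary; the sentence "Assume `v`
is inert: thus `η(ϖ_v) = ζ`, a primitive `l`-th root" of Arthur–Clozel's proof of Thm. 6.2).** For
`E/F` Galois of prime degree `l` there is a Hecke character `η` of `F` vanishing exactly on
`F^× N(𝔸_E^×)` such that `η(ϖ_v) ≠ 1` at every finite place `v` of `F` unramified and inert in `E`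
(`e_v = 1`, `f_v = l`). This is exactly the hypothesis `hCFT` of
`automorphicInduction_character_of_leaves`: existence by `exists_isClassFieldCharacter_holds`, the
Frobenius clause by `IsClassFieldCharacter.valueAtUniformizer_ne_one_of_inert`.
[cite: CasselsFrohlichANT1967, Ch. VII §5.1 Main Theorem (A), (B) and §4.2 Corollary]
[cite: ArthurClozelAMS120, Ch. 3, proof of Thm. 3.1 (p. 201) and proof of Thm. 6.2] -/
theorem exists_isClassFieldCharacter_valueAtUniformizer_ne_one
    (F E : Type) [Field F] [NumberField F] [Field E] [NumberField E] [Algebra F E] [IsGalois F E]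
    (hl : (Module.finrank F E).Prime) :
    ∃ η : GaloisRepresentations.HeckeCharacter F, η.IsClassFieldCharacter E ∧
      ∀ v : HeightOneSpectrum (𝓞 F), v.asIdeal.ramificationIdxIn (𝓞 E) = 1 →
        v.asIdeal.inertiaDegIn (𝓞 E) = Module.finrank F E → η.valueAtUniformizer v ≠ 1 := by
  classical
  haveI : Fact (Module.finrank F E).Prime := ⟨hl⟩
  haveI : FiniteDimensional F E := Module.finite_of_finrank_pos hl.pos
  haveI : IsCyclic (E ≃ₐ[F] E) := isCyclic_of_prime_card (IsGalois.card_aut_eq_finrank F E)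
  obtain ⟨η, hηcf, -⟩ : ∃ η : GaloisRepresentations.HeckeCharacter F,
      η.IsClassFieldCharacter E ∧ orderOf η = Module.finrank F E :=
    exists_isClassFieldCharacter_holds (F := F) (E := E)
  exact ⟨η, hηcf, fun v he hf => hηcf.valueAtUniformizer_ne_one_of_inert hl he hf⟩

/-- **Automorphic induction of a Hecke character in prime degree (Arthur–Clozel 1989, Ch. 3,
Thm. 6.2, `n = 1`; Gelbart 1997, Thm. 5.3.1) from Thm. 4.2 (e) and Borel–Jacquet 4.6 alone.**
Granting, for all number fields, the named facts `ArthurClozel1989_descent_of_galOrbit F E 1`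
(Arthur–Clozel's Thm. 4.2 (e) for `m = 1` in the `L²` model), `AutomorphicRepsGL.exists_cuspidalRepData_of_L2`
and `hasSatakeParamAt_iff_L2` (Borel–Jacquet 1979, 4.6: `L²_cusp ↦` cuspidal data, agreement of
Satake parameters), the named fact `automorphicInduction_character` holds: for `E/F` Galois of
prime degree `l` and `ω` a finite-order Hecke character of `E` with `ω(ϖ_w) ≠ ω(ϖ_{w'})` for two
places `w ≠ w'` above one place, there is a cuspidal `π` on `GL_l(𝔸_F)` with
`det(X - t_{π,v}) = ∏_{w ∣ v}(X^{f(w|v)} - ω(ϖ_w))` for almost all `v`. This is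
`automorphicInduction_character_of_leaves` with its class-field input `hCFT` supplied by
`exists_isClassFieldCharacter_valueAtUniformizer_ne_one`.
[cite: ArthurClozelAMS120, Ch. 3, Thm. 6.2, (6.1)–(6.2) and Thm. 4.2 (e)]
[cite: Gelbart1997, Thm. 5.3.1] [cite: BorelJacquet1979, 4.6] -/
theorem automorphicInduction_character_of_descent_and_BJ
    (h42e : ∀ (F E : Type) [Field F] [NumberField F] [Field E] [NumberField E] [Algebra F E]
      [FiniteDimensional F E], ArthurClozel1989_descent_of_galOrbit F E 1)
    (hB : ∀ {n : ℕ} {K : Type} [Field K] [NumberField K] (hK : isCompact_glFiniteIntegralLevel n K)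
      (μ : Measure (gl n K).automorphicQuotient) [(gl n K).IsAutomorphicMeasure μ],
      AutomorphicRepsGL.exists_cuspidalRepData_of_L2 hK μ)
    (hL2 : ∀ {n : ℕ} {K : Type} [Field K] [NumberField K] (hK : isCompact_glFiniteIntegralLevel n K)
      (μ : Measure (gl n K).automorphicQuotient) [(gl n K).IsAutomorphicMeasure μ],
      hasSatakeParamAt_iff_L2 hK μ) :
    automorphicInduction_character :=
  automorphicInduction_character_of_leaves h42e
    (fun F E _ _ _ _ _ _ hl => exists_isClassFieldCharacter_valueAtUniformizer_ne_one F E hl) hB hL2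

end Literature.NumberTheory.Automorphic

end
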